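import Summits.ResolutionOfSingularities.ResolutionOfSingularities.Theorems.WeightedInvariantELadderOneMeasure
import Summits.ResolutionOfSingularities.ResolutionOfSingularities.Theorems.WeightedInvariantGermContractionChart
import HarnessLib

/-!
# Rung `e = 1` of the door: under the invariant, the closures of distinct maximal singular points are disjoint

Route `ResolutionOfSingularities/WeightedInvariant`, door crux `HypersurfaceCentreConstruction`
(stmt-ResolutionOfSingularities-19897) — OURS, helper; e-ladder `e = 1`, registered stub `stub_e1_centre` of
`res-L1-w43-stub-10` (cell res-hironaka, `D/res-D-pv-025/DOOR-ELADDER-PLAN.md` §7, sub-lemma **L2′-disj**).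

The centre of `stub_e1_centre` is the product, over the finitely many maximal singular points `η` of the stage
(`Stage.maxSing_finite`), of the orbit-wise centres supported on `closure {η}`; the product lemma
`isAdmissibleCentre_of_piece_eq_finsetProd` wants these supports PAIRWISE DISJOINT.  This file derives that from the
invariant `Stage.Inv` (I2): on a chart `W` of the graded atlas through a maximal singular point `η`, the prime `𝔭_η`
of `Γ(Y, W)` is homogeneous with GRADED-SIMPLE quotient (every homogeneous section not in `𝔭_η` is a unit modulo
`𝔭_η`).

* `le_of_isHomogeneous_of_gradedSimple` (pure algebra): if `𝔮` is a homogeneous ideal, `𝔭` is graded-simple, and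
  both lie in a common proper ideal, then `𝔮 ≤ 𝔭` (a homogeneous `x ∈ 𝔮 ∖ 𝔭` would be a unit modulo `𝔭`, forcing
  `1` into the common ideal);
* `primeIdealOf_le_of_mem_closure` / `mem_closure_of_primeIdealOf_le`: on an affine open, `y ∈ closure {η}` iff
  `𝔭_η ≤ 𝔭_y`;
* `Stage.mem_range_of_mem_singImage`, `Stage.exists_chart_of_mem_singImage`: singular image points lie on `i(X)`,
  hence on some chart of the atlas;
* **`Stage.disjoint_closure_of_mem_maxSing`**: under `S.Inv`, for maximal singular points `η ≠ η'`,
  `closure {η} ∩ closure {η'} = ∅` (at a common point `y`, on a chart through `y`: `𝔭_η, 𝔭_{η'} ≤ 𝔭_y`, so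
  `𝔭_{η'} ≤ 𝔭_η` by graded-simplicity, i.e. `η ∈ closure {η'}`, contradicting maximality); equivalently the orbit
  closures `closure {η}` are the connected pieces of the support of the centre.

No named facts. AI-written; weaker than expert review.
-/

noncomputable section

set_option linter.dupNamespace false -- mandated namespace of this single-conjunct summit

open CategoryTheory AlgebraicGeometry TopologicalSpace IsLocalRing Opposite
open Literature.AlgebraicGeometry.Resolution

namespace Summit.ResolutionOfSingularities.ResolutionOfSingularities.Theorems

universe u

/-! ## Graded-simple primes swallow homogeneous ideals below a common proper ideal -/

/-- **A homogeneous ideal lying, together with a graded-simple ideal `𝔭`, inside a common proper ideal is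
contained in `𝔭`.**  (`𝔭` graded-simple: every homogeneous element outside `𝔭` is a unit modulo `𝔭`.) [folklore] -/
theorem le_of_isHomogeneous_of_gradedSimple {ι A : Type*} [DecidableEq ι] [AddMonoid ι] [CommRing A]
    (𝒜 : ι → AddSubgroup A) [GradedRing 𝒜] {𝔭 𝔮 P : Ideal A} (h𝔮 : 𝔮.IsHomogeneous 𝒜)
    (hsimple : ∀ (d : ι) (x : A), x ∈ 𝒜 d → x ∉ 𝔭 → IsUnit (Ideal.Quotient.mk 𝔭 x))
    (h𝔭P : 𝔭 ≤ P) (h𝔮P : 𝔮 ≤ P) (hP : P ≠ ⊤) : 𝔮 ≤ 𝔭 := by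
  classical
  intro x hx
  by_contra hx𝔭
  -- some homogeneous component of `x` lies in `𝔮` but not in `𝔭`
  have hcomp : ∃ d, (DirectSum.decompose 𝒜 x d : A) ∉ 𝔭 := by
    by_contra hall
    push Not at hall
    apply hx𝔭
    rw [← DirectSum.sum_support_decompose 𝒜 x]
    exact Ideal.sum_mem _ fun d _ => hall d
  obtain ⟨d, hd⟩ := hcomp
  have hd𝔮 : (DirectSum.decompose 𝒜 x d : A) ∈ 𝔮 := h𝔮 d hx
  obtain ⟨v, hv⟩ := (hsimple d _ (SetLike.coe_mem _) hd).exists_right_inv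
  obtain ⟨v, rfl⟩ := Ideal.Quotient.mk_surjective v
  rw [← map_mul, ← (Ideal.Quotient.mk 𝔭).map_one, Ideal.Quotient.eq] at hv
  apply hP
  rw [Ideal.eq_top_iff_one]
  have h1 : (DirectSum.decompose 𝒜 x d : A) * v - ((DirectSum.decompose 𝒜 x d : A) * v - 1) = 1 := by ring
  rw [← h1]
  exact P.sub_mem (h𝔮P (𝔮.mul_mem_right _ hd𝔮)) (h𝔭P hv)

/-! ## Specialisation on an affine open, read on primes -/

section Affine

variable {Y : Scheme.{u}} (U : Y.affineOpens)

/-- `y ∈ closure {η}` (both in the affine open `U`) implies `𝔭_η ≤ 𝔭_y`. [folklore] -/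
theorem primeIdealOf_le_of_mem_closure {η y : Y} (hη : η ∈ (U : Y.Opens)) (hy : y ∈ (U : Y.Opens))
    (h : y ∈ closure ({η} : Set Y)) :
    (U.2.primeIdealOf ⟨η, hη⟩).asIdeal ≤ (U.2.primeIdealOf ⟨y, hy⟩).asIdeal :=
  le_asIdeal_of_fromSpec_mem_closure U hη (U.2.primeIdealOf ⟨y, hy⟩)
    (by rw [IsAffineOpen.fromSpec_primeIdealOf]; exact h)

/-- Conversely `𝔭_η ≤ 𝔭_y` implies `y ∈ closure {η}` (`fromSpec` is continuous). [folklore] -/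
theorem mem_closure_of_primeIdealOf_le {η y : Y} (hη : η ∈ (U : Y.Opens)) (hy : y ∈ (U : Y.Opens))
    (h : (U.2.primeIdealOf ⟨η, hη⟩).asIdeal ≤ (U.2.primeIdealOf ⟨y, hy⟩).asIdeal) :
    y ∈ closure ({η} : Set Y) := by
  have hspec : U.2.primeIdealOf ⟨η, hη⟩ ⤳ U.2.primeIdealOf ⟨y, hy⟩ :=
    (PrimeSpectrum.le_iff_specializes _ _).mp h
  have := hspec.map U.2.fromSpec.continuous
  rw [IsAffineOpen.fromSpec_primeIdealOf, IsAffineOpen.fromSpec_primeIdealOf] at this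
  exact specializes_iff_mem_closure.mp this

end Affine

/-! ## Stages: charts through singular points, disjointness of orbit closures -/

namespace ELadderOne.Stage

variable {k : Type} [Field k] (S : Stage k)

/-- Singular image points lie on `i(X)`. [folklore] -/
theorem mem_range_of_mem_singImage {y : S.Y} (hy : y ∈ singImage S.i.ker) : y ∈ Set.range S.i.base := by
  obtain ⟨x, rfl, -⟩ := hy
  have h1 : (S.i.ker.subschemeι.base x : S.Y) ∈ (S.i.ker.support : Set S.Y) := by
    rw [← Scheme.IdealSheafData.range_subschemeι]
    exact ⟨x, rfl⟩
  rw [Scheme.Hom.support_ker, S.i.isClosedEmbedding.isClosed_range.closure_eq] at h1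
  exact h1

/-- Every singular image point lies on some chart of the graded atlas. [folklore] -/
theorem exists_chart_of_mem_singImage {y : S.Y} (hy : y ∈ singImage S.i.ker) :
    ∃ a : S.atlas.ι, y ∈ (S.atlas.W a : S.Y.Opens) := by
  obtain ⟨x, rfl⟩ := S.mem_range_of_mem_singImage hy
  obtain ⟨a, ha, -⟩ := S.atlas.exists_unit x
  exact ⟨a, ha⟩

/-- Points of the closure of a singular image point are singular image points. [folklore] -/
theorem closure_subset_singImage {η : S.Y} (hη : η ∈ singImage S.i.ker) :
    closure ({η} : Set S.Y) ⊆ singImage S.i.ker :=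
  (isClosed_singImage S.f S.i.ker).closure_subset_iff.mpr (Set.singleton_subset_iff.mpr hη)

/-- Distinct maximal singular points do not specialise to one another. [folklore] -/
theorem not_mem_closure_of_mem_maxSing {η η' : S.Y} (hη : η ∈ S.maxSing) (hη' : η' ∈ S.maxSing)
    (hne : η ≠ η') : η ∉ closure ({η'} : Set S.Y) := fun h =>
  hne (hη.2 η' hη'.1 h).symm

/-- **Under the invariant, the closures of distinct maximal singular points are disjoint** (the orbit closures
through the maximal singular points are closed orbits, pairwise disjoint). [folklore] -/
theorem disjoint_closure_of_mem_maxSing (hInv : S.Inv) {η η' : S.Y} (hη : η ∈ S.maxSing)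
    (hη' : η' ∈ S.maxSing) (hne : η ≠ η') :
    Disjoint (closure ({η} : Set S.Y)) (closure ({η'} : Set S.Y)) := by
  rw [Set.disjoint_left]
  intro y hy hy'
  -- a chart through `y`; it contains `η` and `η'`
  obtain ⟨a, hya⟩ := S.exists_chart_of_mem_singImage (S.closure_subset_singImage hη.1 hy)
  have hηa : η ∈ (S.atlas.W a : S.Y.Opens) := by
    obtain ⟨z, hz, hzη⟩ := mem_closure_iff.mp hy _ (S.atlas.W a : S.Y.Opens).isOpen hya
    rw [Set.mem_singleton_iff] at hzη
    exact hzη ▸ hz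
  have hη'a : η' ∈ (S.atlas.W a : S.Y.Opens) := by
    obtain ⟨z, hz, hzη⟩ := mem_closure_iff.mp hy' _ (S.atlas.W a : S.Y.Opens).isOpen hya
    rw [Set.mem_singleton_iff] at hzη
    exact hzη ▸ hz
  letI := S.atlas.gradedRing a
  -- (I2) at `η` and `η'` on this chart
  obtain ⟨-, hsimple⟩ := hInv.2 a η hη hηa
  obtain ⟨hhom', -⟩ := hInv.2 a η' hη' hη'a
  -- `𝔭_{η'} ≤ 𝔭_η`
  have hle : ((S.atlas.W a).2.primeIdealOf ⟨η', hη'a⟩).asIdeal ≤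
      ((S.atlas.W a).2.primeIdealOf ⟨η, hηa⟩).asIdeal :=
    le_of_isHomogeneous_of_gradedSimple (S.atlas.piece a) hhom' hsimple
      (primeIdealOf_le_of_mem_closure (S.atlas.W a) hηa hya hy)
      (primeIdealOf_le_of_mem_closure (S.atlas.W a) hη'a hya hy')
      (Ideal.IsPrime.ne_top inferInstance)
  exact S.not_mem_closure_of_mem_maxSing hη hη' hne
    (mem_closure_of_primeIdealOf_le (S.atlas.W a) hη'a hηa hle)

/-- Hence the supports `closure {η}`, `η ∈ maxSing`, are pairwise disjoint — the hypothesis of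
`isAdmissibleCentre_of_piece_eq_finsetProd`. [folklore] -/
theorem pairwiseDisjoint_closure_maxSing (hInv : S.Inv) :
    S.maxSing.PairwiseDisjoint fun η => closure ({η} : Set S.Y) :=
  fun _ hη _ hη' hne => S.disjoint_closure_of_mem_maxSing hInv hη hη' hne

end ELadderOne.Stage

end Summit.ResolutionOfSingularities.ResolutionOfSingularities.Theorems

end
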